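import Summits.CriticalPhenomena.PercolationContinuityZ3.Theorems.PercNearOneGluingNoHeavyQuantRegateMixture
import Summits.CriticalPhenomena.PercolationContinuityZ3.Theorems.PercNearOneGluingNoHeavyQuantForestData
import Summits.CriticalPhenomena.PercolationContinuityZ3.Theorems.PercNearOneGluingNoHeavyQuantSiblingStepAtoms
import Summits.CriticalPhenomena.PercolationContinuityZ3.Theorems.PercNearOneGluingNoHeavyQuantThreeRootAtomicRegating
import Summits.CriticalPhenomena.PercolationContinuityZ3.Theorems.PercNearOneGluingNoHeavyQuantThreeRootGateStep
import HarnessLib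

/-!
# QUANT lane R8, T-DEC: THE LIGHT-INCREMENT CASE OF THE GATE STEP IS FREE — inside `GateStepN` / `GateStepNCore`, an increment
# `gate c g` whose gated mean `g·R_c` does not exceed its least charged atom is absorbed by ONE-BOX ATOMIC RE-GATING (census-2 g72)

builds on p205010 (kernel theorem, internal audit signed; external expert review pending)

Support file (`--supports stmt-CriticalPhenomena-4575`), QUANT lane seat prim-quant-census-2 (gen 72); memo
`run/shared/lean/prim/quant/prim-quant-census-2-g72/CORE-G72.md` §2.  Theorems only, standard axioms, no sorries.

THE OBSERVATION.  In the binder of the node `LawDec.GateStepN` (budget `n`, oracle "every tree-built law with `< n` nontrivial gates is SDEC",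
environment `μ₁` = `TreeBuiltN x n₁ M₁ μ₁`, increment `gate c g` with `c` = `TreeBuiltN (x/g) n₂ M₂ c`, `n₁ + n₂ + 1 ≤ n`), write the increment's
sub-forest law on its atoms, `c = Σ_m c(m)·δ_m`, and RE-GATE EVERY ATOM TO THE INCREMENT'S OWN MEAN `g·R` (`R = Σ m·c(m)`):
`gate c g = Σ_m (c(m)·m/R) · gate δ_m (g·R/m)` (`regate_mixture`; a genuine mixture iff `g·R ≤ m` for every charged atom `m`, i.e.
`g·R ≤ r_c`, the least charged atom).  Then `μ₁ ∗ gate c g = Σ_m w_m · (μ₁ ∗ gate_{gR/m} δ_m)` is a mixture of forests with the SAME mean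
`R₁ + g·R`, each tree-built at the SAME floor `x` (`gR/m ≥ gR/M₂ > x` by STRICT top-affordability `(x/g)·M₂ < R`, `TreeBuiltN.floor_top_lt`) with
`n₁ + 1 < n` nontrivial gates — ORACLE INSTANCES.  Under any outer gate `q` every piece is DEC at the common target `q(R₁ + gR)` at every
layer (`sdec_gate`, `decAt_of_sdec`), so the mixture is (`decAtT_mixture_finset`): the forest is SDEC at `x`.  No floor is touched (the
environment is never re-gated; the re-gated atoms are blobs with marginal `gR/m > x`), which is why — unlike the all-atoms family
(`decAt_gate_flaw_atomic`, regime `a·fmean ≤ Σ qᵢrᵢ`) — the condition involves NO outer gate: the case is free for EVERY outer gate.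

* `LawDec.TreeBuiltN.floor_top_lt` — strict top-affordability `x·M < mean` of a tree-built law with `M ≥ 1`.
* `LawDec.TreeBuiltN.eq_point_of_gates_zero` — a tree-built law with no nontrivial gate is the point mass `δ_M`.
* `LawDec.gate_eq_sum_regated_atoms` — the one-box atomic re-gating identity above.
* **`LawDec.gateStepN_of_lightIncrement`** — THE THEOREM: in `GateStepN`'s binder with `1 ≤ n₂`, `0 < M₂` and `g·R ≤ m` for every charged
  atom `m` of `c`: `SDEC x (M₁ + M₂) (μ₁ ∗ gate c g)`.
* **`LawDec.gateStepNCore_of_lightIncrement`** — the same in `GateStepNCore`'s binder (environment `a ∗ b`, increment `c` not a point mass).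

READING (README V400 / V410 format).  For the sibling step with `k` composite siblings `tᵢ = gate_{qᵢ} ρᵢ`: IF SOME sibling `j` has
`qⱼ·Rⱼ ≤ rⱼ` (least charged atom of `ρⱼ`; for a 2-chain box `R[1](R[s])`: `qⱼ(1 + sⱼ) ≤ 1`), the instance is FREE (take `μ₁` = the other
siblings, `gate c g = tⱼ`).  On prim-quant-arm-1 g46's generic list of 300 three-2-chain forests (seed 2026) this frees 276/300 by itself
(identity I: 180, all-atoms atomic: 169, their union: 259; natural ten-shape menu LP: 298), including 19/21 of the band `a ≥ .95`; on the tied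
family `o[a](R[q](R[s]))³` it is the region `q(1+s) ≤ 1` (all `a`).  The genuinely open population is "every sibling heavy-rooted"
(`qⱼ > rⱼ/Rⱼ` for all `j`; 2-chains: `qⱼ > 1/(1+sⱼ) ≥ 1/2`), which contains the lead's pinned near-tied core (E*: `q(1+s) = 1.425`).
HONEST STATUS: a free sub-case; `GateStepNCore`, `SiblingStep`, `FarTreeRow` OPEN; RATE class log\* / honest sentence unchanged.
[this work]; re-gating bookkeeping `regate_mixture`: prim-quant-arm-1 g46; `TreeBuiltN`, the node: lead g42 / typer g39 (this lane).  Nothing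
here is cited as a published result.  The gluing rows served [cite: KozmaNitzan2024, Conjecture 3 (p. 15)]; product measure
[cite: Grimmett1999, §1.3 p. 10].
-/

noncomputable section

open scoped BigOperators

namespace Summit.CriticalPhenomena.PercolationContinuityZ3.Theorems
namespace Quant
namespace LawDec

open Finset

/-! ### Two facts about tree-built laws -/

/-- **strict top-affordability**: a tree-built law with top `M ≥ 1` has `x·M < mean` (the sure relay is strict, `x < 1`; the other
constructors preserve strictness). [this work] -/
theorem TreeBuiltN.floor_top_lt {x : ℝ} {n M : ℕ} {μ : ℕ → ℝ} (h : TreeBuiltN x n M μ) :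
    0 < M → x * (M : ℝ) < ∑ k ∈ Finset.range (M + 1), (k : ℝ) * μ k := by
  induction h with
  | nil x₀ hx0 hx1 => intro hM; exact absurd hM (lt_irrefl 0)
  | relay x₀ hx0 hx1 =>
    intro _
    simp
    exact hx1
  | @conv x₀ n₁ n₂ M₁ M₂ μ₁ μ₂ h₁ h₂ ih₁ ih₂ =>
    intro hM
    obtain ⟨_, _, _, _, s1, t1⟩ := h₁.lawFacts
    obtain ⟨_, _, _, _, s2, t2⟩ := h₂.lawFacts
    rw [sum_mul_lconv M₁ M₂ μ₁ μ₂ s1 s2, Nat.cast_add, mul_add]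
    rcases Nat.eq_zero_or_pos M₁ with hM₁ | hM₁
    · have hM₂ : 0 < M₂ := by omega
      have := ih₂ hM₂
      linarith
    · have := ih₁ hM₁
      linarith
  | @gate x₀ n₀ M₀ μ₀ q hq0 hq1 h ih =>
    intro hM
    rw [sum_mul_gate]
    have := ih hM
    have : q * (x₀ * (M₀ : ℝ)) < q * ∑ k ∈ Finset.range (M₀ + 1), (k : ℝ) * μ₀ k := mul_lt_mul_of_pos_left this hq0
    linarith
  | @mono x₀ x' n₀ M₀ μ₀ h hx'0 hxx ih =>
    intro hM
    have := ih hM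
    have : x' * (M₀ : ℝ) ≤ x₀ * M₀ := mul_le_mul_of_nonneg_right hxx (Nat.cast_nonneg _)
    linarith

/-- the convolution of two point masses is a point mass. [this work] -/
theorem lconv_point_point (M₁ M₂ : ℕ) :
    lconv M₁ M₂ (fun h => if h = M₁ then (1 : ℝ) else 0) (fun h => if h = M₂ then (1 : ℝ) else 0)
      = fun h => if h = M₁ + M₂ then (1 : ℝ) else 0 := by
  have hv : ∀ h, M₁ < h → (fun h => if h = M₁ then (1 : ℝ) else 0) h = 0 := fun h hh => if_neg (by omega)
  rw [← gate_one (fun h => if h = M₂ then (1 : ℝ) else 0), lconv_gate_point_eq_slice M₁ M₂ _ 1 hv]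
  funext h
  simp only [slice]
  by_cases hle : M₂ ≤ h
  · rw [if_pos hle]
    by_cases hh : h = M₁ + M₂
    · rw [if_pos hh, if_pos (show h - M₂ = M₁ by omega)]; ring
    · rw [if_neg hh, if_neg (show ¬ (h - M₂ = M₁) by omega)]
      split_ifs <;> ring
  · rw [if_neg hle, if_neg (show ¬ (h = M₁ + M₂) by omega)]
    split_ifs <;> ring

/-- **a tree-built law with no nontrivial gate is the point mass `δ_M`** (a convolution of `δ₀`'s and sure relays). [this work] -/
theorem TreeBuiltN.eq_point_of_gates_zero {x : ℝ} {n M : ℕ} {μ : ℕ → ℝ} (h : TreeBuiltN x n M μ) :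
    n = 0 → μ = fun k => if k = M then (1 : ℝ) else 0 := by
  induction h with
  | nil x₀ hx0 hx1 => intro _; rfl
  | relay x₀ hx0 hx1 => intro _; rfl
  | @conv x₀ n₁ n₂ M₁ M₂ μ₁ μ₂ h₁ h₂ ih₁ ih₂ =>
    intro hn
    rw [ih₁ (by omega), ih₂ (by omega)]
    exact lconv_point_point M₁ M₂
  | @gate x₀ n₀ M₀ μ₀ q hq0 hq1 h ih => intro hn; exact absurd hn (Nat.succ_ne_zero n₀)
  | @mono x₀ x' n₀ M₀ μ₀ h hx'0 hxx ih => exact ih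

/-! ### One-box atomic re-gating of the increment -/

/-- **THE ONE-BOX ATOMIC RE-GATING IDENTITY**: for a law `c` on `{0..M}` (mass `1`, `c 0 = 0`, mean `R ≠ 0`) and a gate `g`,
`gate c g = Σ_{m ≤ M} (c m·m/R) · gate δ_m (g·R/m)` — every atom re-gated to the common mean `g·R`. [this work] -/
theorem gate_eq_sum_regated_atoms (M : ℕ) (c : ℕ → ℝ) (g : ℝ) (hcM : ∀ h, M < h → c h = 0)
    (hc1 : ∑ h ∈ Finset.range (M + 1), c h = 1) (hc0 : c 0 = 0)
    (hR : (∑ h ∈ Finset.range (M + 1), (h : ℝ) * c h) ≠ 0) (k : ℕ) :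
    gate c g k = ∑ m ∈ Finset.range (M + 1),
      (c m * (m : ℝ) / ∑ h ∈ Finset.range (M + 1), (h : ℝ) * c h) *
        gate (fun h => if h = m then (1 : ℝ) else 0) (g * (∑ h ∈ Finset.range (M + 1), (h : ℝ) * c h) / m) k := by
  set R : ℝ := ∑ h ∈ Finset.range (M + 1), (h : ℝ) * c h with hRdef
  rw [gate_eq_sum_atoms M c g hcM hc1 k]
  refine regate_mixture (Finset.range (M + 1)) c (fun m => c m * (m : ℝ) / R) (fun m => g * R / (m : ℝ))
    (fun m => fun h => if h = m then (1 : ℝ) else 0) g hc1 ?_ ?_ k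
  · rw [← Finset.sum_div, div_eq_one_iff_eq hR, hRdef]
    exact Finset.sum_congr rfl fun m _ => by ring
  · intro m _
    by_cases h0 : m = 0
    · subst h0; simp [hc0]
    · have hm : (m : ℝ) ≠ 0 := Nat.cast_ne_zero.2 h0
      field_simp

/-! ### The theorem -/

/-- **THE LIGHT-INCREMENT CASE OF THE GATE STEP IS FREE.**  Inside `GateStepN`'s binder (budget `n`, oracle `hO`, environment
`TreeBuiltN x n₁ M₁ μ₁`, increment sub-forest `TreeBuiltN (x/g) n₂ M₂ c` with `1 ≤ n₂`, `0 < M₂`, `n₁ + n₂ + 1 ≤ n`, `0 < x < g < 1`):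
IF `g·R_c ≤ m` for every charged atom `m` of `c` (`R_c` the mean of `c`), THEN `μ₁ ∗ gate c g` is SDEC at `x`.  Proof: the one-box
atomic re-gating identity makes the forest a mixture of the forests `μ₁ ∗ gate_{gR/m} δ_m` (common mean, common floor `x`, `≤ n₁ + 1 < n`
gates) — oracle instances; under any outer gate every piece is DEC at the common target at every layer; mixtures. [this work] -/
theorem gateStepN_of_lightIncrement (n : ℕ) (x g : ℝ) (n₁ n₂ M₁ M₂ : ℕ) (μ₁ c : ℕ → ℝ)
    (hO : ∀ (x' : ℝ) (n' M' : ℕ) (μ' : ℕ → ℝ), n' < n → TreeBuiltN x' n' M' μ' → SDEC x' M' μ')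
    (hn : n₁ + n₂ + 1 ≤ n) (hn₂ : 1 ≤ n₂) (hx0 : 0 < x) (hxg : x < g) (hg1 : g < 1)
    (h₁ : TreeBuiltN x n₁ M₁ μ₁) (hc : TreeBuiltN (x / g) n₂ M₂ c) (hM₂ : 0 < M₂)
    (hlight : ∀ m, 0 < c m → g * (∑ h ∈ Finset.range (M₂ + 1), (h : ℝ) * c h) ≤ m) :
    SDEC x (M₁ + M₂) (lconv M₁ M₂ μ₁ (gate c g)) := by
  classical
  have hg0 : 0 < g := lt_trans hx0 hxg
  obtain ⟨_, hx1, m0, mM, m1, mta⟩ := h₁.lawFacts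
  obtain ⟨hy0, hy1, c0, cM, c1, _⟩ := hc.lawFacts
  set R₁ : ℝ := ∑ h ∈ Finset.range (M₁ + 1), (h : ℝ) * μ₁ h with hR₁
  set R : ℝ := ∑ h ∈ Finset.range (M₂ + 1), (h : ℝ) * c h with hR
  -- strict top-affordability of `c` at floor `x/g`: `x·M₂ < g·R`
  have hstrict : x / g * (M₂ : ℝ) < R := hc.floor_top_lt hM₂
  have hxR : x * (M₂ : ℝ) < g * R := by
    have := mul_lt_mul_of_pos_left hstrict hg0
    rwa [← mul_assoc, mul_div_cancel₀ x hg0.ne'] at this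
  have hR0 : 0 < R := by
    have : 0 < x * (M₂ : ℝ) := mul_pos hx0 (by exact_mod_cast hM₂)
    nlinarith
  have hgR0 : 0 < g * R := mul_pos hg0 hR0
  -- no charged atom at `0`
  have hc00 : c 0 = 0 := by
    by_contra hne
    have hpos : 0 < c 0 := lt_of_le_of_ne (c0 0) (Ne.symm hne)
    have := hlight 0 hpos
    simp only [Nat.cast_zero] at this
    linarith
  -- weights and gates of the pieces
  set w : ℕ → ℝ := fun m => c m * (m : ℝ) / R with hw
  set gm : ℕ → ℝ := fun m => g * R / (m : ℝ) with hgm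
  have hw0 : ∀ m, 0 ≤ w m := fun m => div_nonneg (mul_nonneg (c0 m) (Nat.cast_nonneg m)) hR0.le
  have hw1 : ∑ m ∈ Finset.range (M₂ + 1), w m = 1 := by
    simp only [hw]
    rw [← Finset.sum_div, div_eq_one_iff_eq hR0.ne', hR]
    exact Finset.sum_congr rfl fun m _ => by ring
  -- a charged piece: its atom `m` is `≥ 1`, `≤ M₂`, charged in `c`, and `x < gm m ≤ 1`
  have hcharged : ∀ m ∈ Finset.range (M₂ + 1), 0 < w m → 0 < c m ∧ 1 ≤ m ∧ m ≤ M₂ ∧ 0 < gm m ∧ gm m ≤ 1 ∧ x < gm m ∧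
      gm m * (m : ℝ) = g * R := by
    intro m hm hwm
    have hmM : m ≤ M₂ := Nat.lt_succ_iff.1 (Finset.mem_range.1 hm)
    have hcm : 0 < c m := by
      by_contra hle
      have hz : c m = 0 := le_antisymm (not_lt.1 hle) (c0 m)
      simp only [hw, hz, zero_mul, zero_div] at hwm
      exact lt_irrefl _ hwm
    have hm1 : 1 ≤ m := by
      by_contra hlt
      have : m = 0 := by omega
      subst this
      exact absurd hc00 hcm.ne'
    have hmpos : (0 : ℝ) < m := by exact_mod_cast hm1
    have hgm0 : 0 < gm m := div_pos hgR0 hmpos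
    have hgm1 : gm m ≤ 1 := by
      simp only [hgm]; rw [div_le_one hmpos]; exact hlight m hcm
    have hxgm : x < gm m := by
      simp only [hgm]; rw [lt_div_iff₀ hmpos]
      have : x * (m : ℝ) ≤ x * (M₂ : ℝ) := mul_le_mul_of_nonneg_left (by exact_mod_cast hmM) hx0.le
      linarith
    refine ⟨hcm, hm1, hmM, hgm0, hgm1, hxgm, ?_⟩
    simp only [hgm]; exact div_mul_cancel₀ _ hmpos.ne'
  -- a charged piece is tree-built at floor `x` with `≤ n₁ + 1` gates, hence SDEC by the oracle
  have hpiece : ∀ m ∈ Finset.range (M₂ + 1), 0 < w m →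
      ∃ n', n' ≤ n₁ + 1 ∧ TreeBuiltN x n' (M₁ + m) (lconv M₁ m μ₁ (gate (fun h => if h = m then (1 : ℝ) else 0) (gm m))) := by
    intro m hm hwm
    obtain ⟨_, _, _, hgm0, hgm1, hxgm, _⟩ := hcharged m hm hwm
    have hz0 : 0 < x / gm m := div_pos hx0 hgm0
    have hz1 : x / gm m < 1 := by rw [div_lt_one hgm0]; exact hxgm
    obtain ⟨n', hn', hb⟩ := exists_gate_of_treeBuiltN (treeBuiltN_point m hz0 hz1) (gm m) hgm0 hgm1
    rw [mul_div_cancel₀ x hgm0.ne'] at hb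
    exact ⟨n₁ + n', by omega, TreeBuiltN.conv h₁ hb⟩
  -- the forest as the mixture of the pieces
  have hforest : ∀ k, lconv M₁ M₂ μ₁ (gate c g) k =
      ∑ m ∈ Finset.range (M₂ + 1), w m * lconv M₁ M₂ μ₁ (gate (fun h => if h = m then (1 : ℝ) else 0) (gm m)) k := by
    intro k
    have e : gate c g = fun k => ∑ m ∈ Finset.range (M₂ + 1),
        w m * gate (fun h => if h = m then (1 : ℝ) else 0) (gm m) k :=
      funext fun k => gate_eq_sum_regated_atoms M₂ c g cM c1 hc00 hR0.ne' k
    rw [e, lconv_fsum_right]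
  -- SDEC of the mixture
  intro q hq0 hq1 j _
  have hqx1 : q * x < 1 := by nlinarith
  -- the mean of the gated forest
  have hmean : ∑ h ∈ Finset.range (M₁ + M₂ + 1), (h : ℝ) * gate (lconv M₁ M₂ μ₁ (gate c g)) q h = q * (R₁ + g * R) := by
    rw [sum_mul_gate, sum_mul_lconv M₁ M₂ μ₁ (gate c g) m1 (sum_gate c g M₂ c1), sum_mul_gate]
  rw [decAt_iff_decAtT, hmean]
  have e2 : ∀ k, gate (lconv M₁ M₂ μ₁ (gate c g)) q k = ∑ m ∈ Finset.range (M₂ + 1),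
      w m * gate (lconv M₁ M₂ μ₁ (gate (fun h => if h = m then (1 : ℝ) else 0) (gm m))) q k := by
    intro k
    rw [show lconv M₁ M₂ μ₁ (gate c g) = fun k => ∑ m ∈ Finset.range (M₂ + 1),
        w m * lconv M₁ M₂ μ₁ (gate (fun h => if h = m then (1 : ℝ) else 0) (gm m)) k from funext hforest]
    exact gate_sum_affine _ _ _ _ hw1 k
  refine decAtT_congr (fun k => (e2 k).symm) (decAtT_mixture_finset (Finset.range (M₂ + 1)) w _
    (fun m _ => hw0 m) hw1 fun m hm hwm => ?_)
  -- every charged piece, under the outer gate `q`, is DEC at the common target `q(R₁ + gR)` at every layer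
  obtain ⟨hcm, hm1, hmM, hgm0, hgm1, hxgm, hgmm⟩ := hcharged m hm hwm
  obtain ⟨n', hn', hP⟩ := hpiece m hm hwm
  set P : ℕ → ℝ := lconv M₁ m μ₁ (gate (fun h => if h = m then (1 : ℝ) else 0) (gm m)) with hPdef
  have hSP : SDEC x (M₁ + m) P := hO x n' (M₁ + m) P (by omega) hP
  have hSPq : SDEC (q * x) (M₁ + m) (gate P q) := sdec_gate hSP q hq0 hq1
  obtain ⟨n'', _, hPq⟩ := exists_gate_of_treeBuiltN hP q hq0 hq1
  obtain ⟨_, _, P0, PM, P1, Pta⟩ := hPq.lawFacts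
  have hd : DECAt (q * x) j (M₁ + m) (gate P q) := decAt_of_sdec hSPq (mul_pos hq0 hx0) hqx1 P0 PM P1 Pta j
  rw [decAt_iff_decAtT] at hd
  -- the piece's mean under `q` is the common target
  have hδM : ∀ h, m < h → gate (fun h => if h = m then (1 : ℝ) else 0) (gm m) h = 0 := by
    intro h hh; rw [gate_apply, if_neg (by omega), if_neg (by omega)]; ring
  have hδ1 : ∑ h ∈ Finset.range (m + 1), gate (fun h => if h = m then (1 : ℝ) else 0) (gm m) h = 1 :=
    sum_gate _ _ _ (by rw [Finset.sum_ite_eq' (Finset.range (m + 1)) m]; simp)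
  have hmeanP : ∑ h ∈ Finset.range (M₁ + m + 1), (h : ℝ) * gate P q h = q * (R₁ + g * R) := by
    rw [sum_mul_gate, hPdef, sum_mul_lconv M₁ m μ₁ _ m1 hδ1, sum_mul_gate, ← hR₁]
    have : ∑ h ∈ Finset.range (m + 1), (h : ℝ) * (fun h => if h = m then (1 : ℝ) else 0) h = m := by
      rw [Finset.sum_eq_single m]
      · simp
      · intro b _ hb; simp [hb]
      · intro h; exact absurd (Finset.mem_range.2 (Nat.lt_succ_self m)) h
    rw [this, hgmm]
  rw [hmeanP] at hd
  -- lift the top `M₁ + m ≤ M₁ + M₂` and identify the piece's law on the larger top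
  refine decAtT_congr (fun k => ?_) (decAtT_mono_top hd (by omega))
  rw [gate_apply, gate_apply, hPdef, lconv_top_right_of_le M₁ m M₂ μ₁ _ hmM hδM k]

/-- **THE LIGHT-INCREMENT CASE OF THE CORE.**  In `GateStepNCore`'s binder (environment `a ∗ b`, increment sub-forest `c` not a point mass,
`na + nb + n₂ + 1 ≤ n`): if `g·R_c ≤ m` for every charged atom `m` of `c`, then `(a ∗ b) ∗ gate c g` is SDEC at `x`.  (`c` not a point mass
gives `0 < M₂` and `1 ≤ n₂` by `TreeBuiltN.eq_point_of_gates_zero`.) [this work] -/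
theorem gateStepNCore_of_lightIncrement (n : ℕ) (x g : ℝ) (na nb n₂ Ma Mb M₂ : ℕ) (a b c : ℕ → ℝ)
    (hO : ∀ (x' : ℝ) (n' M' : ℕ) (μ' : ℕ → ℝ), n' < n → TreeBuiltN x' n' M' μ' → SDEC x' M' μ')
    (hn : na + nb + n₂ + 1 ≤ n) (hx0 : 0 < x) (hxg : x < g) (hg1 : g < 1)
    (ha : TreeBuiltN x na Ma a) (hb : TreeBuiltN x nb Mb b) (hc : TreeBuiltN (x / g) n₂ M₂ c)
    (hnp : ∀ K : ℕ, c ≠ fun h => if h = K then (1 : ℝ) else 0)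
    (hlight : ∀ m, 0 < c m → g * (∑ h ∈ Finset.range (M₂ + 1), (h : ℝ) * c h) ≤ m) :
    SDEC x (Ma + Mb + M₂) (lconv (Ma + Mb) M₂ (lconv Ma Mb a b) (gate c g)) := by
  have hn₂ : 1 ≤ n₂ := by
    by_contra hlt
    exact hnp M₂ (hc.eq_point_of_gates_zero (by omega))
  have hM₂ : 0 < M₂ := by
    by_contra hle
    have hM : M₂ = 0 := by omega
    obtain ⟨_, _, c0, cM, c1, _⟩ := hc.lawFacts
    apply hnp 0
    funext h
    by_cases hh : h = 0
    · subst hh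
      rw [hM, zero_add, Finset.sum_range_one] at c1
      rw [c1, if_pos rfl]
    · rw [if_neg hh]
      exact cM h (by omega)
  exact gateStepN_of_lightIncrement n x g (na + nb) n₂ (Ma + Mb) M₂ (lconv Ma Mb a b) c hO (by omega) hn₂ hx0 hxg hg1
    (TreeBuiltN.conv ha hb) hc hM₂ hlight

end LawDec
end Quant
end Summit.CriticalPhenomena.PercolationContinuityZ3.Theorems
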